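import Mathlib
import Summits.KontsevichZagierPeriods.KontsevichZagierPeriods.Theorems.SoloInformedCubeResolution
import Summits.KontsevichZagierPeriods.KontsevichZagierPeriods.Theorems.SoloInformedKZUnitCube
import HarnessLib
import HarnessLib.Audit

/-!
# SoloInformed — the crux of the Ayoub transfer lives on the unit cube

By THEOREM B′ (`soloInformed_kzUnitCube`: every integral representation is KZ-equivalent to a sum
of representations with domain `[0,1]ⁿ`), the open resolution statement
`SoloInformedAyoubCubeResolution` of the Ayoub transfer follows from its restriction to
representations `[[0,1]ⁿ, f]` (`f` a `ℚ`-semialgebraic integrable function on the unit cube):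

* `SoloInformedAyoubCubeResolutionCube` (conjecture, the remaining crux): for every such `f` there
  are `k ≠ 0`, cube germs `G_j` (algebraic functions complex-analytic near closed cubes, real on
  real points) and `c_j ∈ ℤ` with `k · [[0,1]ⁿ, f] ≡ ∑ c_j · [[0,1]^{d_j}, Re G_j]` under the moves;
* `soloInformed_cubeResolution_of_cube` : `…Cube → SoloInformedAyoubCubeResolution`
  (common multiple `K = ∏ k_i` of the multiplicities of the `3ⁿ` cube pieces, then flattening);
* `soloInformed_cubeResolutionCube_iff` : the two resolution statements are equivalent;
* `soloInformed_ayoubTransfer₅ : SoloInformedAyoubCubeResolutionCube → SoloInformedAyoubKZeffQ →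
  KontsevichZagierPeriods` — the summit from the cube crux and Ayoub's conjecture up to torsion.

References: J. Ayoub, EMS Newsl. 91 (2014), §2.2; Kontsevich–Zagier 2001, §1.2.
-/

noncomputable section

open scoped BigOperators
open MeasureTheory Set
open Literature.NumberTheory.Transcendental Literature.NumberTheory.Transcendental.KZ

namespace Summit.KontsevichZagierPeriods.KontsevichZagierPeriods.Theorems

/-- **The cube crux.** Every representation *on the unit cube* is KZ-equivalent, up to a positive
multiple, to an integer combination of cube integrals of real parts of cube germs. Open: a
resolution-of-singularities statement inside the KZ calculus (triangulation, Nash parametrisation,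
blow-ups and ramified substitutions making the integrand analytic up to the boundary).
[Ayoub 2014, §2.2, Def. 9–10, Prop. 11; Kontsevich–Zagier 2001, §1.2] -/
@[conjecture] def SoloInformedAyoubCubeResolutionCube : Prop :=
  ∀ (n : ℕ) (r : IntegralRep n), r.domain = soloInformedCube n →
    ∃ (k : ℕ) (_ : k ≠ 0) (m : ℕ) (d : Fin m → ℕ)
      (G : ∀ j, SoloInformedCubeGerm (d j)) (c : Fin m → ℤ) (ρ : ∀ j, IntegralRep (d j)),
      (∀ j, (ρ j).domain = soloInformedCube (d j)) ∧
      (∀ j, EqOn (ρ j).integrand (fun x => ((G j).g (soloInformedToC (d j) x)).re)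
        (soloInformedCube (d j))) ∧
      k • of r - ∑ j, c j • of (ρ j) ∈ relations

/-- Common-multiple bookkeeping in an additive commutative group: if `K = k_i · w_i` for all `i`,
then
`K • x − ∑ᵢ ∑ⱼ (w_i c_ij) • y_ij = K • (x − ∑ᵢ x_i) + ∑ᵢ w_i • (k_i • x_i − ∑ⱼ c_ij • y_ij)`. -/
theorem soloInformed_common_multiple_identity {A : Type*} [AddCommGroup A] {ι : Type*}
    [Fintype ι] {κ : ι → Type*} [∀ i, Fintype (κ i)] (K : ℕ) (k w : ι → ℕ)
    (hK : ∀ i, k i * w i = K) (x : A) (xs : ι → A) (c : ∀ i, κ i → ℤ) (y : ∀ i, κ i → A) :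
    K • x - ∑ i, ∑ j, ((w i : ℤ) * c i j) • y i j =
      K • (x - ∑ i, xs i) + ∑ i, (w i) • ((k i) • xs i - ∑ j, c i j • y i j) := by
  have h1 : ∀ i, (w i) • ((k i) • xs i - ∑ j, c i j • y i j) =
      K • xs i - ∑ j, ((w i : ℤ) * c i j) • y i j := fun i => by
    rw [smul_sub, smul_smul, mul_comm, hK i, Finset.smul_sum]
    congr 1
    exact Finset.sum_congr rfl fun j _ => by rw [← smul_smul, natCast_zsmul]
  simp only [h1, Finset.sum_sub_distrib, smul_sub, Finset.smul_sum]
  abel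

/-- **The cube crux implies the resolution statement** (hence THEOREM P_A): apply THEOREM B′,
resolve each of the `3ⁿ` cube pieces, take the product of the multiplicities and flatten.
[Kontsevich–Zagier 2001, §1.2] -/
theorem soloInformed_cubeResolution_of_cube (h : SoloInformedAyoubCubeResolutionCube) :
    SoloInformedAyoubCubeResolution := by
  intro n r
  obtain ⟨M, rs, hdom, hrel⟩ := soloInformed_kzUnitCube r
  choose k hk m d G c ρ hd hI hrelk using fun i => h n (rs i) (hdom i)
  classical
  -- common multiple
  set K : ℕ := ∏ i, k i with hKdef
  have hK0 : K ≠ 0 := Finset.prod_ne_zero_iff.2 fun i _ => hk i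
  set w : Fin M → ℕ := fun i => ∏ i' ∈ Finset.univ.erase i, k i' with hw
  have hK : ∀ i, k i * w i = K := fun i => Finset.mul_prod_erase _ _ (Finset.mem_univ i)
  -- flattening
  let σ : Fin (∑ i, m i) ≃ (Σ i : Fin M, Fin (m i)) := finSigmaFinEquiv.symm
  refine ⟨K, hK0, ∑ i, m i, fun l => d (σ l).1 (σ l).2, fun l => G (σ l).1 (σ l).2,
    fun l => (w (σ l).1 : ℤ) * c (σ l).1 (σ l).2, fun l => ρ (σ l).1 (σ l).2, fun l => hd _ _,
    fun l => hI _ _, ?_⟩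
  have hsum : ∑ l, ((w (σ l).1 : ℤ) * c (σ l).1 (σ l).2) • of (ρ (σ l).1 (σ l).2) =
      ∑ i, ∑ j, ((w i : ℤ) * c i j) • of (ρ i j) := by
    rw [σ.sum_comp (fun p : Σ i : Fin M, Fin (m i) => ((w p.1 : ℤ) * c p.1 p.2) • of (ρ p.1 p.2)),
      Fintype.sum_sigma]
  rw [hsum, soloInformed_common_multiple_identity K k w hK (of r) (fun i => of (rs i)) c
    fun i j => of (ρ i j)]
  exact relations.add_mem (relations.nsmul_mem hrel K)
    (relations.sum_mem fun i _ => relations.nsmul_mem (hrelk i) (w i))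

/-- The cube crux is equivalent to the resolution statement (the converse is restriction). -/
theorem soloInformed_cubeResolutionCube_iff :
    SoloInformedAyoubCubeResolutionCube ↔ SoloInformedAyoubCubeResolution :=
  ⟨soloInformed_cubeResolution_of_cube, fun h n r _ => h n r⟩

/-- The cube crux is equivalent to THEOREM P_A (`SoloInformedAyoubPresentation`). -/
theorem soloInformed_cubeResolutionCube_iff_presentation :
    SoloInformedAyoubCubeResolutionCube ↔ SoloInformedAyoubPresentation :=
  soloInformed_cubeResolutionCube_iff.trans soloInformed_cubeResolution_iff_presentation

/-- **The Ayoub transfer from the cube crux**: the cube crux and Ayoub's conjecture up to torsion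
imply the Kontsevich–Zagier period conjecture. [Ayoub 2014, §2.2, Conj. 7, Prop. 11, Rem. 13] -/
theorem soloInformed_ayoubTransfer₅ (hR : SoloInformedAyoubCubeResolutionCube)
    (hA : SoloInformedAyoubKZeffQ) : KontsevichZagierPeriods :=
  soloInformed_ayoubTransfer₄ (soloInformed_cubeResolution_of_cube hR) hA

end Summit.KontsevichZagierPeriods.KontsevichZagierPeriods.Theorems
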